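import Summits.QuantumFields.BalabanUV.T4Continuum.Support.NE9EarleHamiltonChain

/-!
# NE9FutureProfileStep — ROUTE R4 «FADING BY EARLE–HAMILTON», THE INSTANCE IN FUTURE-INFLUENCE COORDINATES, PART 1: the state
# space 𝔛 = 𝔜 × ℓ^∞(ℕ × W; Pot), the shift, the step `S k g`, the orbit, and the kernel's hypothesis `HoloSelfMaps` BY NAME
# (cell `pub-balaban`, T4-DAG §6 NE9, route R4 of `t4/ROUTES-NE9.md` v4 §L1.0 EH1–EH2; INTERFACE REQUEST NE9 (R4-3) worded by the
# BINDER row NE9 OWNER `b2b-balaban-t4-ne9-p1` gen 60, CLAIMS.log l.28192; unit `b2b-balaban-t4-ne9-formalise-leaf-04` gen 45;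
# HOME pre-build F-ne9leaf04g45-1 56445b4012700b9d; imports the kernel module `NE9EarleHamiltonChain` (R4-1) ONLY; modifies nothing)

HONEST FRAMING (T4-DAG PAGE 1).  Rung (B)+1 of the FINITE-VOLUME T⁴ programme — NOT infinite volume, NOT a mass gap, NOT the
Clay problem.  NE9 (`T4OutputRate.NE9` ∧ `FadingMemory`) is a cell NEW ESTIMATE, NOT PRINTED in [I] = [Balaban1987RG1] (CMP 109),
[II] = [Balaban1988RG2Cluster] (CMP 116), and NOT PROVED for Bałaban's E^{(j)} («NE9 ⇐ the named binders»; spine PROVED 0∕9; row NE9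
WALLED ON A MODEL, O-NE9-1).  HONEST DEPENDENCY (cell line, verbatim): continuum YM on T⁴ ⇐ BetaPertH ∧ nine spine estimates (0/9
proved); BetaPertH ⇐ (D1) ∧ (D4) ∧ CAP+tail; G-an2-4 gates asym, D1 and NE2/3/4.  `FlowStep.BetaPertH`, (B), (B^μ) do not occur.
This file is GENERIC complex-Banach bookkeeping: it constructs NO object of Bałaban's and discharges NO Bałaban-side hypothesis;
nothing printed is asserted (ABSOLUTE RULE); no `def … : Prop` hypothesis is minted; 0 sorry.

WHAT THIS FILE DOES (route R4 EH1∕EH2, `t4/ROUTES-NE9.md` §L1.0; PRICING-NE9 v4 §B).  Given complex normed spaces 𝔜 (slices) and `Pot`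
(tables), a window `W`, new-slice maps `Φ k s : Pot → 𝔜` — to be INSTANTIATED by the σ-SYMMETRISED complex slice map (real on real
tables; owner decision (D3) l.28192 after leaf-02 g30's (δ), TYPE unchanged) — and injections `J k : 𝔜 →L[ℂ] Fut W Pot`, it DEFINES the
discrete index `Idx W` (steps ahead × comparison coupling sequences), `Fut W Pot := (Idx W) →ᵇ Pot` (sup norm), the `shift`, the STEP
`step W Φ J τ₀ ωh k g (y, x) := (τ₀ • Φ k (g k) (x ⟨0, g⟩), ωh • shift x + J k (Φ k (g k) (x ⟨0, g⟩)))` and the ORBIT `emb` from a common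
initial state, and PROVES: `mapsTo_step` (EH2 (iii): size `B₀` of `Φ k (g k)` on the `r`-ball + `‖J k‖ ≤ τ₀` + ROOM `ωh·r + τ₀·B₀ ≤ θ·r` ⇒
θ-self-map — no occupation hypothesis, no margin), `holoSelfMaps_step` (+ FRÉCHET holomorphy of `Φ k (g k)` on the `r`-ball ⇒
`NE9EarleHamiltonChain.HoloSelfMaps (step …) W r θ` BY NAME), `last_step` (the 𝔜-level last-coupling pair at the actual state — the
shape of `T4HistoryLipschitzOuter.LastCouplingLipschitz`, complex-valued — ⇒ the END's `hlast` with `τ₀·lam k`), `read_of_coord` (a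
weighted coordinate read-out ⇒ the END's `hread`), and §6 the injection `injRead` from ℂ-LINEAR per-slice readings with geometric
weights (`‖Rd (j+n) j s‖ ≤ τ₀·ωⁿ`, `ω ≤ ωh` ⇒ `‖J k‖ ≤ τ₀`; g-INDEPENDENT because filed at every `s ∈ W`).  PART 2 (`NE9FutureProfileEnd`)
composes these with the kernel.  Binders (B1)–(B4) are DISPLAYED hypotheses; their record-level dischargers ((B2) ℝ-linearity of the
channel on Adm — owner (R4-4); (B3) = (R-1a); (B1) holomorphy = route item P2) are NOT in this file.

References (TYPES ∕ loci only): [EH1970] C. J. Earle, R. S. Hamilton, Proc. Symp. Pure Math. XVI (1970) 61–65; [Balaban1988RG2Cluster]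
T. Bałaban, CMP **116** (1988) 1–22, (1.23)–(1.29) pp. 7–8, (1.33)–(1.36) p. 9, p. 8 l. 9–10, (2.38) p. 20; [Balaban1987RG1] T. Bałaban,
CMP **109** (1987), (2.13) p. 268, p. 263.  Summits-side NEW work (LEAN PLACEMENT RULE).
-/

noncomputable section

namespace Summit.QuantumFields.BalabanUV.T4Continuum.NE9FutureProfileStep

open Metric Set
open scoped BigOperators
open Literature.MathematicalPhysics.QuantumFieldTheory.Balaban1983to89.T4OutputRate
open Literature.MathematicalPhysics.QuantumFieldTheory.Balaban1983to89.T4HistoryLipschitzRecursion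
  (prodModuli prodModuli_const fadingMemory_geometric)
open Summit.QuantumFields.BalabanUV.T4Continuum.NE9EarleHamiltonChain

/-! ## §1 The index of future-influence coordinates and the bounded-function space -/

/-- The DISCRETE index of future-influence coordinates: `n` steps ahead, at the comparison coupling sequence `s` of the window
`W` (route R4 EH1: `x(n, s)` = the channel reading, `n` steps ahead and at every admissible coupling sequence, of the terms
that exist now). [folklore] -/
structure Idx (W : Set (ℕ → ℝ)) where
  /-- steps ahead [folklore] -/
  n : ℕ
  /-- comparison coupling sequence of the window [folklore] -/
  s : W

/-- The DISCRETE topology on the index (so that `BoundedContinuousFunction (Idx W) Pot = ℓ^∞(Idx W; Pot)`). [folklore] -/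
instance (W : Set (ℕ → ℝ)) : TopologicalSpace (Idx W) := ⊥

/-- The index topology is discrete by definition. [folklore] -/
instance (W : Set (ℕ → ℝ)) : DiscreteTopology (Idx W) := ⟨rfl⟩

/-- The space of future channel profiles `ℓ^∞(ℕ × W; Pot)`, realised as Mathlib's bounded continuous functions on the discrete
index (sup norm). [folklore] -/
abbrev Fut (W : Set (ℕ → ℝ)) (Pot : Type*) [NormedAddCommGroup Pot] [NormedSpace ℂ Pot] : Type _ :=
  BoundedContinuousFunction (Idx W) Pot

section pack

variable {I : Type*} [TopologicalSpace I] [DiscreteTopology I]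
variable {𝔜 Pot : Type*} [NormedAddCommGroup 𝔜] [NormedSpace ℂ 𝔜] [NormedAddCommGroup Pot] [NormedSpace ℂ Pot]

/-- (pointwise datum of `packCLM`) [folklore] -/
def packFun (A : I → (𝔜 →L[ℂ] Pot)) (M : ℝ) (hA : ∀ i, ‖A i‖ ≤ M) (F : 𝔜) : BoundedContinuousFunction I Pot :=
  BoundedContinuousFunction.ofNormedAddCommGroupDiscrete (fun i => A i F) (M * ‖F‖) fun i => (A i).le_of_opNorm_le (hA i) F

/-- Pointwise value of `packFun`. [folklore] -/
@[simp] theorem packFun_apply (A : I → (𝔜 →L[ℂ] Pot)) (M : ℝ) (hA : ∀ i, ‖A i‖ ≤ M) (F : 𝔜) (i : I) :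
    packFun A M hA F i = A i F := rfl

/-- PACK a uniformly bounded family of bounded linear maps `A i : 𝔜 →L[ℂ] Pot` into ONE bounded linear map
`𝔜 →L[ℂ] (I →ᵇ Pot)`. [folklore] -/
def packCLM (A : I → (𝔜 →L[ℂ] Pot)) (M : ℝ) (hM : 0 ≤ M) (hA : ∀ i, ‖A i‖ ≤ M) : 𝔜 →L[ℂ] (BoundedContinuousFunction I Pot) :=
  LinearMap.mkContinuous
    { toFun := packFun A M hA,
      map_add' := fun F G => by ext i; simp only [packFun_apply, map_add, BoundedContinuousFunction.coe_add, Pi.add_apply],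
      map_smul' := fun c F => by
        ext i; simp only [packFun_apply, map_smul, BoundedContinuousFunction.coe_smul, RingHom.id_apply] }
    M (fun F => (BoundedContinuousFunction.norm_le (by positivity)).2 fun i => (A i).le_of_opNorm_le (hA i) F)

/-- Pointwise value of `packCLM`. [folklore] -/
theorem packCLM_apply (A : I → (𝔜 →L[ℂ] Pot)) (M : ℝ) (hM : 0 ≤ M) (hA : ∀ i, ‖A i‖ ≤ M)
    (F : 𝔜) (i : I) : packCLM A M hM hA F i = A i F := rfl

/-- The packed map has operator norm at most the uniform bound `M`. [folklore] -/
theorem norm_packCLM_le (A : I → (𝔜 →L[ℂ] Pot)) (M : ℝ) (hM : 0 ≤ M) (hA : ∀ i, ‖A i‖ ≤ M) :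
    ‖packCLM A M hM hA‖ ≤ M :=
  LinearMap.mkContinuous_norm_le _ hM _

omit [NormedSpace ℂ Pot] in
/-- (pointwise datum of `reindexCLM`) [folklore] -/
def reindexFun (σ : I → I) (x : BoundedContinuousFunction I Pot) : BoundedContinuousFunction I Pot :=
  BoundedContinuousFunction.ofNormedAddCommGroupDiscrete (fun i => x (σ i)) ‖x‖ fun i => x.norm_coe_le_norm (σ i)

omit [NormedSpace ℂ Pot] in
/-- Pointwise value of `reindexFun`. [folklore] -/
@[simp] theorem reindexFun_apply (σ : I → I) (x : BoundedContinuousFunction I Pot) (i : I) :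
    reindexFun σ x i = x (σ i) := rfl

/-- REINDEX bounded functions along any self-map of the index (e.g. the shift); norm ≤ 1. [folklore] -/
def reindexCLM (σ : I → I) : BoundedContinuousFunction I Pot →L[ℂ] BoundedContinuousFunction I Pot :=
  LinearMap.mkContinuous
    { toFun := reindexFun σ,
      map_add' := fun x y => by ext i; simp only [reindexFun_apply, BoundedContinuousFunction.coe_add, Pi.add_apply],
      map_smul' := fun c x => by
        ext i; simp only [reindexFun_apply, BoundedContinuousFunction.coe_smul, RingHom.id_apply] }
    1 (fun x => by
      rw [one_mul]
      exact (BoundedContinuousFunction.norm_le (norm_nonneg _)).2 fun i => x.norm_coe_le_norm (σ i))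

/-- Pointwise value of `reindexCLM`. [folklore] -/
theorem reindexCLM_apply (σ : I → I) (x : BoundedContinuousFunction I Pot) (i : I) :
    reindexCLM σ x i = x (σ i) := rfl

/-- Reindexing has operator norm at most `1`. [folklore] -/
theorem norm_reindexCLM_le (σ : I → I) : ‖(reindexCLM σ : BoundedContinuousFunction I Pot →L[ℂ] _)‖ ≤ 1 :=
  LinearMap.mkContinuous_norm_le _ zero_le_one _

/-- Reindexing does not increase the sup norm. [folklore] -/
theorem norm_reindexCLM_apply_le (σ : I → I) (x : BoundedContinuousFunction I Pot) : ‖reindexCLM (Pot := Pot) σ x‖ ≤ ‖x‖ := by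
  simpa only [one_mul] using (reindexCLM (Pot := Pot) σ).le_of_opNorm_le (norm_reindexCLM_le σ) x

end pack

/-! ## §2 The step and the orbit in future-influence coordinates -/

variable {𝔜 Pot : Type*} [NormedAddCommGroup 𝔜] [NormedSpace ℂ 𝔜] [NormedAddCommGroup Pot] [NormedSpace ℂ Pot]
variable (W : Set (ℕ → ℝ))

/-- The SHIFT of future channel profiles: `(shift x)(n, s) = x(n+1, s)` (route R4 EH2; norm ≤ 1). [folklore] -/
def shift : Fut W Pot →L[ℂ] Fut W Pot := reindexCLM (fun i : Idx W => ⟨i.n + 1, i.s⟩)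

/-- Pointwise value of the shift. [folklore] -/
theorem shift_apply (x : Fut W Pot) (i : Idx W) : shift W x i = x ⟨i.n + 1, i.s⟩ := rfl

/-- The shift does not increase the sup norm (route R4 EH2: `‖shift‖ ≤ 1`). [folklore] -/
theorem norm_shift_apply_le (x : Fut W Pot) : ‖shift W x‖ ≤ ‖x‖ := norm_reindexCLM_apply_le _ x

variable (Φ : ℕ → ℝ → Pot → 𝔜) (J : ℕ → (𝔜 →L[ℂ] Fut W Pot)) (τ₀ ωh : ℝ)

open Classical in
/-- THE STEP `S k g` IN FUTURE-INFLUENCE COORDINATES (route R4 EH2): the new slice `Φ k (g k) (x (0, g))` (scaled by `τ₀`) and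
the updated profile `ωh • shift x + J k (new slice)`; zero off the window. [folklore] -/
def step (k : ℕ) (g : ℕ → ℝ) (z : 𝔜 × Fut W Pot) : 𝔜 × Fut W Pot :=
  if hg : g ∈ W then
    ((τ₀ : ℂ) • Φ k (g k) (z.2 ⟨0, ⟨g, hg⟩⟩), (ωh : ℂ) • shift W z.2 + J k (Φ k (g k) (z.2 ⟨0, ⟨g, hg⟩⟩)))
  else 0

/-- THE ORBIT (actual states): `emb 0 g = e₀` (common initial state), `emb (k+1) g = S k g (emb k g)`. [folklore] -/
def emb (e₀ : 𝔜 × Fut W Pot) : ℕ → (ℕ → ℝ) → 𝔜 × Fut W Pot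
  | 0, _ => e₀
  | k + 1, g => step W Φ J τ₀ ωh k g (emb e₀ k g)

/-- The slice created at the step `j+1` along the orbit of `g ∈ W` (the 𝔜-component of `emb (j+1) g` is `τ₀ •` this):
`Φ j (g j)` at the CURRENT table `x_j^g (0, g)`. [folklore] -/
def newSlice (e₀ : 𝔜 × Fut W Pot) (j : ℕ) (g : ℕ → ℝ) (hg : g ∈ W) : 𝔜 :=
  Φ j (g j) ((emb W Φ J τ₀ ωh e₀ j g).2 ⟨0, ⟨g, hg⟩⟩)

variable {W Φ J τ₀ ωh}

/-- The step on the window, unfolded. [folklore] -/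
theorem step_of_mem {k : ℕ} {g : ℕ → ℝ} (hg : g ∈ W) (z : 𝔜 × Fut W Pot) :
    step W Φ J τ₀ ωh k g z =
      ((τ₀ : ℂ) • Φ k (g k) (z.2 ⟨0, ⟨g, hg⟩⟩), (ωh : ℂ) • shift W z.2 + J k (Φ k (g k) (z.2 ⟨0, ⟨g, hg⟩⟩))) :=
  dif_pos hg

/-- The orbit starts at the common initial state. [folklore] -/
@[simp] theorem emb_zero (e₀ : 𝔜 × Fut W Pot) (g : ℕ → ℝ) : emb W Φ J τ₀ ωh e₀ 0 g = e₀ := rfl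

/-- The orbit recursion (route R4 EH2 (i) `hfac`, by construction). [folklore] -/
@[simp] theorem emb_succ (e₀ : 𝔜 × Fut W Pot) (k : ℕ) (g : ℕ → ℝ) :
    emb W Φ J τ₀ ωh e₀ (k + 1) g = step W Φ J τ₀ ωh k g (emb W Φ J τ₀ ωh e₀ k g) := rfl

/-- The slice coordinate after a step: `τ₀ •` the new slice. [folklore] -/
theorem emb_succ_fst (e₀ : 𝔜 × Fut W Pot) (j : ℕ) {g : ℕ → ℝ} (hg : g ∈ W) :
    (emb W Φ J τ₀ ωh e₀ (j + 1) g).1 = (τ₀ : ℂ) • newSlice W Φ J τ₀ ωh e₀ j g hg := by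
  rw [emb_succ, step_of_mem hg]
  rfl

/-- The profile coordinate after a step: discounted SHIFT of the old profile plus the INJECTION of the new slice (route R4
EH2 (i), «shift is exact re-indexing»). [folklore] -/
theorem emb_succ_snd_apply (e₀ : 𝔜 × Fut W Pot) (j : ℕ) {g : ℕ → ℝ} (hg : g ∈ W) (i : Idx W) :
    (emb W Φ J τ₀ ωh e₀ (j + 1) g).2 i =
      (ωh : ℂ) • (emb W Φ J τ₀ ωh e₀ j g).2 ⟨i.n + 1, i.s⟩ + J j (newSlice W Φ J τ₀ ωh e₀ j g hg) i := by
  rw [emb_succ, step_of_mem hg]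
  rfl

/-! ## §3 EH2 (iii): the step is a θ-self-map with room — `θ·r ≥ ωh·r + τ₀·B₀` (room N2♭) -/

omit [NormedSpace ℂ 𝔜] in
/-- A coordinate of a profile in the open `r`-ball of 𝔛 lies in the open `r`-ball of `Pot`. [folklore] -/
theorem apply_snd_mem_ball {r : ℝ} {z : 𝔜 × Fut W Pot} (hz : z ∈ ball (0 : 𝔜 × Fut W Pot) r) (i : Idx W) :
    z.2 i ∈ ball (0 : Pot) r := by
  rw [mem_ball_zero_iff] at hz ⊢
  exact ((z.2.norm_coe_le_norm i).trans (norm_snd_le z)).trans_lt hz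

/-- **EH2 (iii) — SELF-MAP WITH ROOM.**  If the new-slice map is bounded by `B₀` on the `r`-ball of tables and `‖J k‖ ≤ τ₀`, then
`S k g` maps the open `r`-ball of 𝔛 into the closed `θ r`-ball as soon as `ωh·r + τ₀·B₀ ≤ θ·r`.  No occupation hypothesis, no
margin `R₀ − s₀`. [folklore] -/
theorem mapsTo_step {r B₀ θ : ℝ} (hτ₀ : 0 ≤ τ₀) (hωh : 0 ≤ ωh)
    (hΦb : ∀ k, ∀ g ∈ W, MapsTo (Φ k (g k)) (ball (0 : Pot) r) (closedBall 0 B₀))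
    (hJ : ∀ k, ‖J k‖ ≤ τ₀) (hθ : ωh * r + τ₀ * B₀ ≤ θ * r) (k : ℕ) {g : ℕ → ℝ} (hg : g ∈ W) :
    MapsTo (step W Φ J τ₀ ωh k g) (ball (0 : 𝔜 × Fut W Pot) r) (closedBall 0 (θ * r)) := by
  intro z hz
  have hzr : ‖z‖ < r := mem_ball_zero_iff.mp hz
  have hP : ‖Φ k (g k) (z.2 ⟨0, ⟨g, hg⟩⟩)‖ ≤ B₀ :=
    mem_closedBall_zero_iff.mp (hΦb k g hg (apply_snd_mem_ball hz _))
  have h1 : ‖(τ₀ : ℂ) • Φ k (g k) (z.2 ⟨0, ⟨g, hg⟩⟩)‖ ≤ τ₀ * B₀ := by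
    rw [norm_smul, Complex.norm_real, Real.norm_of_nonneg hτ₀]
    exact mul_le_mul_of_nonneg_left hP hτ₀
  have h2 : ‖(ωh : ℂ) • shift W z.2 + J k (Φ k (g k) (z.2 ⟨0, ⟨g, hg⟩⟩))‖ ≤ ωh * r + τ₀ * B₀ := by
    refine (norm_add_le _ _).trans (add_le_add ?_ ?_)
    · rw [norm_smul, Complex.norm_real, Real.norm_of_nonneg hωh]
      exact mul_le_mul_of_nonneg_left (((norm_shift_apply_le W z.2).trans (norm_snd_le z)).trans hzr.le) hωh
    · exact ((J k).le_of_opNorm_le (hJ k) _).trans (mul_le_mul (le_refl _) hP (norm_nonneg _) hτ₀)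
  have hωr : 0 ≤ ωh * r := mul_nonneg hωh ((norm_nonneg z).trans hzr.le)
  rw [mem_closedBall_zero_iff, step_of_mem hg, Prod.norm_mk]
  exact max_le (h1.trans ((le_add_of_nonneg_left hωr).trans hθ)) (h2.trans hθ)

/-! ## §4 EH2 (ii): holomorphy of the step from FRÉCHET holomorphy of the new-slice map (P2's output, assumed) -/

/-- **EH2 (ii)+(iii) — `HoloSelfMaps`.**  The step `S k g = (bounded affine) ∘ Φ k (g k) ∘ ev_{(0,g)}` is Fréchet-holomorphic on
the `r`-ball of 𝔛 as soon as `Φ k (g k)` is Fréchet-holomorphic on the `r`-ball of `Pot`; with §3 this is the kernel's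
hypothesis `HoloSelfMaps S W r θ` BY NAME. [folklore] -/
theorem holoSelfMaps_step {r B₀ θ : ℝ} (hτ₀ : 0 ≤ τ₀) (hωh : 0 ≤ ωh)
    (hΦd : ∀ k, ∀ g ∈ W, DifferentiableOn ℂ (Φ k (g k)) (ball (0 : Pot) r))
    (hΦb : ∀ k, ∀ g ∈ W, MapsTo (Φ k (g k)) (ball (0 : Pot) r) (closedBall 0 B₀))
    (hJ : ∀ k, ‖J k‖ ≤ τ₀) (hθ : ωh * r + τ₀ * B₀ ≤ θ * r) :
    HoloSelfMaps (step W Φ J τ₀ ωh) W r θ := by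
  intro k g hg
  refine ⟨?_, mapsTo_step hτ₀ hωh hΦb hJ hθ k hg⟩
  -- the evaluation at the index (0, g) composed with the second projection is a bounded linear map
  have hev : DifferentiableOn ℂ (fun z : 𝔜 × Fut W Pot => z.2 ⟨0, ⟨g, hg⟩⟩) (ball 0 r) :=
    (((BoundedContinuousFunction.evalCLM ℂ (⟨0, ⟨g, hg⟩⟩ : Idx W)).comp
      (ContinuousLinearMap.snd ℂ 𝔜 (Fut W Pot))).differentiable.differentiableOn).congr fun _ _ => rfl
  have hΦc : DifferentiableOn ℂ (fun z : 𝔜 × Fut W Pot => Φ k (g k) (z.2 ⟨0, ⟨g, hg⟩⟩)) (ball 0 r) :=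
    (hΦd k g hg).comp hev fun z hz => apply_snd_mem_ball hz _
  have h1 : DifferentiableOn ℂ (fun z : 𝔜 × Fut W Pot => (τ₀ : ℂ) • Φ k (g k) (z.2 ⟨0, ⟨g, hg⟩⟩)) (ball 0 r) :=
    hΦc.const_smul (τ₀ : ℂ)
  have h2 : DifferentiableOn ℂ
      (fun z : 𝔜 × Fut W Pot => (ωh : ℂ) • shift W z.2 + J k (Φ k (g k) (z.2 ⟨0, ⟨g, hg⟩⟩))) (ball 0 r) :=
    (((shift W).differentiable.comp differentiable_snd).differentiableOn.const_smul (ωh : ℂ)).add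
      ((J k).differentiable.comp_differentiableOn hΦc)
  have h12 := h1.prodMk h2
  refine h12.congr fun z _ => ?_
  exact step_of_mem hg z

/-! ## §5 EH4's instance hypotheses: last coupling (B3) and read-out (B4) pushed to 𝔛 -/

/-- **`hlast` ON 𝔛.**  The 𝔜-level last-coupling pair at the actual state (same history `emb k g`, two last couplings; the
shape of `T4HistoryLipschitzOuter.LastCouplingLipschitz`, complex-valued) gives the 𝔛-level bound with constant `τ₀·lam k`:
the `ωh • shift` parts CANCEL, the slice part carries `τ₀`, the profile part `‖J k‖ ≤ τ₀`. [folklore] -/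
theorem last_step (e₀ : 𝔜 × Fut W Pot) {lam : ℕ → ℝ} (hτ₀ : 0 ≤ τ₀) (hJ : ∀ k, ‖J k‖ ≤ τ₀)
    (hΦlast : ∀ k, ∀ g (hg : g ∈ W), ∀ g' (hg' : g' ∈ W),
      ‖Φ k (g k) ((emb W Φ J τ₀ ωh e₀ k g).2 ⟨0, ⟨g, hg⟩⟩) -
          Φ k (g' k) ((emb W Φ J τ₀ ωh e₀ k g).2 ⟨0, ⟨g', hg'⟩⟩)‖ ≤ lam k * |g k - g' k|) :
    ∀ k, ∀ g ∈ W, ∀ g' ∈ W,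
      ‖step W Φ J τ₀ ωh k g (emb W Φ J τ₀ ωh e₀ k g) - step W Φ J τ₀ ωh k g' (emb W Φ J τ₀ ωh e₀ k g)‖ ≤
        τ₀ * lam k * |g k - g' k| := by
  intro k g hg g' hg'
  set e := emb W Φ J τ₀ ωh e₀ k g with he
  set P := Φ k (g k) (e.2 ⟨0, ⟨g, hg⟩⟩) with hP
  set P' := Φ k (g' k) (e.2 ⟨0, ⟨g', hg'⟩⟩) with hP'
  have hΔ : ‖P - P'‖ ≤ lam k * |g k - g' k| := hΦlast k g hg g' hg'
  have hdiff : step W Φ J τ₀ ωh k g e - step W Φ J τ₀ ωh k g' e = ((τ₀ : ℂ) • (P - P'), J k (P - P')) := by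
    rw [step_of_mem hg, step_of_mem hg', Prod.mk_sub_mk, smul_sub, map_sub]
    congr 1
    abel
  rw [hdiff, Prod.norm_mk, mul_assoc]
  refine max_le ?_ ?_
  · rw [norm_smul, Complex.norm_real, Real.norm_of_nonneg hτ₀]
    exact mul_le_mul_of_nonneg_left hΔ hτ₀
  · exact ((J k).le_of_opNorm_le (hJ k) _).trans (mul_le_mul_of_nonneg_left hΔ hτ₀)

/-- **`hread` ON 𝔛.**  A weighted coordinate read-out of the slice component (B4) — `E g U X = Re (coord U X (emb (scale X) g).1)`
with `‖coord U X‖ ≤ cY·e^{−κ d(X)}` — gives the END's read-out hypothesis with `cR = cY` (the slice component is dominated by the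
sup norm of the pair). [folklore] -/
theorem read_of_coord {C : Carriers} {Bg : Type} (E : Functional C Bg) (e₀ : 𝔜 × Fut W Pot)
    (coord : Bg → C.Dom → (𝔜 →L[ℂ] ℂ)) {κ cY : ℝ}
    (hcoord : ∀ U X, ‖coord U X‖ ≤ cY * Real.exp (-(κ * C.d X)))
    (hE : ∀ g ∈ W, ∀ (U : Bg) (X : C.Dom), E g U X = (coord U X (emb W Φ J τ₀ ωh e₀ (C.scale X) g).1).re) :
    ∀ g ∈ W, ∀ g' ∈ W, ∀ (U : Bg) (X : C.Dom),
      |E g U X - E g' U X| ≤ Real.exp (-(κ * C.d X)) *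
        (cY * ‖emb W Φ J τ₀ ωh e₀ (C.scale X) g - emb W Φ J τ₀ ωh e₀ (C.scale X) g'‖) := by
  intro g hg g' hg' U X
  set e := emb W Φ J τ₀ ωh e₀ (C.scale X) g
  set e' := emb W Φ J τ₀ ωh e₀ (C.scale X) g'
  have hcY : 0 ≤ cY * Real.exp (-(κ * C.d X)) := (norm_nonneg _).trans (hcoord U X)
  rw [hE g hg U X, hE g' hg' U X, ← Complex.sub_re, ← map_sub]
  calc |(coord U X (e.1 - e'.1)).re| ≤ ‖coord U X (e.1 - e'.1)‖ := Complex.abs_re_le_norm _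
    _ ≤ cY * Real.exp (-(κ * C.d X)) * ‖e.1 - e'.1‖ := (coord U X).le_of_opNorm_le (hcoord U X) _
    _ ≤ cY * Real.exp (-(κ * C.d X)) * ‖e - e'‖ := by
        refine mul_le_mul_of_nonneg_left ?_ hcY
        rw [← Prod.fst_sub]
        exact norm_fst_le _
    _ = Real.exp (-(κ * C.d X)) * (cY * ‖e - e'‖) := by ring

/-! ## §6 (B2) from per-slice readings with geometric weights: the injection `J k` and its norm -/

/-- The weighted family of per-slice readings that `J k` packs: at `n` steps ahead and comparison couplings `s`, the reading at
the step `k+1+n` of a slice created at the step `k+1`, weighted UP by `ωh⁻ⁿ`. [folklore] -/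
def readFamily (Rd : ℕ → ℕ → (ℕ → ℝ) → (𝔜 →L[ℂ] Pot)) (ωh : ℝ) (k : ℕ) (i : Idx W) : 𝔜 →L[ℂ] Pot :=
  ((ωh⁻¹ : ℝ) ^ i.n : ℂ) • Rd (k + 1 + i.n) (k + 1) (i.s : ℕ → ℝ)

/-- **GEOMETRIC READINGS ARE UNIFORMLY BOUNDED AFTER UP-WEIGHTING**: `‖Rd (j+n) j s‖ ≤ τ₀·ωⁿ` with `0 < ω ≤ ωh` gives
`‖ωh⁻ⁿ • Rd (k+1+n) (k+1) s‖ ≤ τ₀` (the far future is weighted up but decays faster — route R4 EH1 «Size»). [folklore] -/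
theorem norm_readFamily_le (Rd : ℕ → ℕ → (ℕ → ℝ) → (𝔜 →L[ℂ] Pot)) {τ₀ ω ωh : ℝ} (hτ₀ : 0 ≤ τ₀) (hω : 0 ≤ ω)
    (hωh : 0 < ωh) (hωωh : ω ≤ ωh)
    (hRd : ∀ (j n : ℕ), ∀ s ∈ W, ‖Rd (j + n) j s‖ ≤ τ₀ * ω ^ n) (k : ℕ) (i : Idx W) :
    ‖readFamily Rd ωh k i‖ ≤ τ₀ := by
  unfold readFamily
  rw [norm_smul, norm_pow, Complex.norm_real, Real.norm_of_nonneg (inv_nonneg.mpr hωh.le)]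
  have h := hRd (k + 1) i.n i.s i.s.2
  calc (ωh⁻¹) ^ i.n * ‖Rd (k + 1 + i.n) (k + 1) (i.s : ℕ → ℝ)‖ ≤ (ωh⁻¹) ^ i.n * (τ₀ * ω ^ i.n) :=
        mul_le_mul_of_nonneg_left h (pow_nonneg (inv_nonneg.mpr hωh.le) _)
    _ = τ₀ * (ω / ωh) ^ i.n := by rw [div_eq_mul_inv, mul_pow]; ring
    _ ≤ τ₀ * 1 := mul_le_mul_of_nonneg_left (pow_le_one₀ (div_nonneg hω hωh.le) ((div_le_one hωh).mpr hωωh)) hτ₀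
    _ = τ₀ := mul_one _

/-- **THE INJECTION `J k` FROM READINGS** (route R4 EH2: `(J k F)(n, s) = ωh⁻ⁿ • Rd (k+1+n) (k+1) s F`), a bounded linear map
`𝔜 →L[ℂ] Fut W Pot` with `‖J k‖ ≤ τ₀` — `g`-INDEPENDENT because the readings are filed at EVERY `s ∈ W`. [folklore] -/
def injRead (Rd : ℕ → ℕ → (ℕ → ℝ) → (𝔜 →L[ℂ] Pot)) {τ₀ ω ωh : ℝ} (hτ₀ : 0 ≤ τ₀) (hω : 0 ≤ ω) (hωh : 0 < ωh)
    (hωωh : ω ≤ ωh) (hRd : ∀ (j n : ℕ), ∀ s ∈ W, ‖Rd (j + n) j s‖ ≤ τ₀ * ω ^ n) (k : ℕ) : 𝔜 →L[ℂ] Fut W Pot :=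
  packCLM (readFamily Rd ωh k) τ₀ hτ₀ (norm_readFamily_le Rd hτ₀ hω hωh hωωh hRd k)

/-- Pointwise value of the injection built from readings. [folklore] -/
theorem injRead_apply (Rd : ℕ → ℕ → (ℕ → ℝ) → (𝔜 →L[ℂ] Pot)) {τ₀ ω ωh : ℝ} (hτ₀ : 0 ≤ τ₀) (hω : 0 ≤ ω) (hωh : 0 < ωh)
    (hωωh : ω ≤ ωh) (hRd : ∀ (j n : ℕ), ∀ s ∈ W, ‖Rd (j + n) j s‖ ≤ τ₀ * ω ^ n) (k : ℕ) (F : 𝔜) (i : Idx W) :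
    injRead Rd hτ₀ hω hωh hωωh hRd k F i = ((ωh⁻¹ : ℝ) ^ i.n : ℂ) • Rd (k + 1 + i.n) (k + 1) (i.s : ℕ → ℝ) F := rfl

/-- `‖J k‖ ≤ τ₀` for the injection built from geometric readings (route R4 EH2, binder (B2)). [folklore] -/
theorem norm_injRead_le (Rd : ℕ → ℕ → (ℕ → ℝ) → (𝔜 →L[ℂ] Pot)) {τ₀ ω ωh : ℝ} (hτ₀ : 0 ≤ τ₀) (hω : 0 ≤ ω) (hωh : 0 < ωh)
    (hωωh : ω ≤ ωh) (hRd : ∀ (j n : ℕ), ∀ s ∈ W, ‖Rd (j + n) j s‖ ≤ τ₀ * ω ^ n) (k : ℕ) :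
    ‖injRead Rd hτ₀ hω hωh hωωh hRd k‖ ≤ τ₀ :=
  norm_packCLM_le _ _ hτ₀ _

/-! ## §10 Non-vacuity of the Banach-level binders (a linear toy: every hypothesis of §4 inhabited with θ < 1) -/

/-- TOY: on `𝔜 = Pot = ℂ` with `Φ k s P := (s : ℂ) + (1/4 : ℂ) * P`, `J k := 0`, `τ₀ = 1/4`, `ωh = 1/2`, window `]0, 1/8]`,
radius `r = 1`, `B₀ = 3/8`: the step is a holomorphic self-map of the unit ball of 𝔛 into the closed `θ`-ball, `θ = 19/32 < 1`
(room N2♭: `1/2·1 + 1/4·3/8 = 19/32`). [folklore] -/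
example : HoloSelfMaps
    (step (𝔜 := ℂ) (Pot := ℂ) (Window (1 / 8)) (fun _ s P => (s : ℂ) + (1 / 4 : ℂ) * P) (fun _ => 0) (1 / 4) (1 / 2))
    (Window (1 / 8)) 1 (19 / 32) := by
  refine holoSelfMaps_step (B₀ := 3 / 8) (by norm_num) (by norm_num) (fun _ _ _ => ?_) (fun k g hg => ?_)
    (fun k => by rw [norm_zero]; norm_num) (by norm_num)
  · exact ((differentiable_const _).add ((differentiable_const _).mul differentiable_id)).differentiableOn
  · intro P hP
    rw [mem_ball_zero_iff] at hP
    rw [mem_closedBall_zero_iff]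
    have hs := (mem_window.mp hg k)
    calc ‖(g k : ℂ) + (1 / 4 : ℂ) * P‖ ≤ ‖(g k : ℂ)‖ + ‖(1 / 4 : ℂ) * P‖ := norm_add_le _ _
      _ = |g k| + 1 / 4 * ‖P‖ := by
          rw [Complex.norm_real, Real.norm_eq_abs, norm_mul]
          norm_num
      _ ≤ 1 / 8 + 1 / 4 * 1 := add_le_add (by rw [abs_of_pos hs.1]; exact hs.2) (by gcongr)
      _ = 3 / 8 := by norm_num


end Summit.QuantumFields.BalabanUV.T4Continuum.NE9FutureProfileStep

end
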